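import Mathlib
import Summits.NavierStokesRegularity.NavierStokesRegularity.Theorems.EulerZoomLiouvillePowerGaugeEulerLiouvilleSelfSimilarOffRatePast
import Summits.NavierStokesRegularity.NavierStokesRegularity.Theorems.EulerZoomLiouvillePowerGaugeEulerLiouvilleEnergySaturationNegRate
import Summits.NavierStokesRegularity.NavierStokesRegularity.Theorems.EulerZoomLiouvillePowerGaugeEulerLiouvilleSelfSimilarNegClockPastGrowth
import HarnessLib

/-!
# WEAK NEGATIVE-RATE POWER CLOCKS ARE TRIVIAL: a collapse about ANY space–time point `(T, x₀)` on a past sub-slab `τ < T₁` at a rate `g < 0`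
# vanishes — weak class, no profile hypothesis, no energy bound
# (crux `EulerZoomLiouville.PowerGaugeEulerLiouville` = stmt-NavierStokesRegularity-19832; line `logtime-breathers`, residue T4 `stub_powerClockRest`)

Route `EulerZoomLiouville` (NavierStokesRegularity); extra-width seat ns-ezl-w7 (cell ns-regularity-ideate, LEAD ns-typeII-p2 g11).  Euler's power clocks
`u(τ, x) = (T−τ)^{g−1} W((T−τ)^{−g}(x − x₀))`, `p(τ, x) = (T−τ)^{2(g−1)} P((T−τ)^{−g}(x − x₀))` in Seregin's power-gauged class: the tree kills the
rates `g > 1/(2+ρ)` (`OffRate.*`, ns-ezl-w4) and `0 < g < 2/5` (`SlowClock.*`, ns-ezl-w6) about any `(T, x₀)` on past sub-slabs in the WEAK class, and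
`g < 1/(2+ρ)` about the final time (`PastShape.*`); the rate `g = 0` is ns-ezl-w6's `…SelfSimilarSeparablePast`.  THIS FILE: the NEGATIVE rates
`g < 0` about any `(T, x₀)`, `τ < T₁` — `NegClock.selfSimilar_ae_eq_zero_of_neg_rate_past`, weak class, ANY profile.  It supersedes in content this
seat's Lagrangian stratum `NegRateClock.ae_eq_zero_of_gauge_of_tameNegRateClock` (classical, tame profile; `…PowerClockNegRate`).

MECHANISM = ns-ezl-w6's lever run at a negative rate (`EnergySaturation.ae_eq_zero_of_negRate_loc`, `…EnergySaturationNegRate`): the profile inherits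
the CLASS-`ρ` large-scale data (A₁)(E₁)(D₁) from the gauges (`NegClock.profile_energy_growth_of_gaugeA_past_negRate` here; the `E`/`D` bricks of
`…SelfSimilarNegClockPastGrowth`), the weak Poisson equation and the profile local energy EQUALITY at the literal rate `g`
(`ProfileEnergy.profile_local_energy_equality`, rate-free); the scale ODE `(R^κJ)' = g⁻¹R^{κ−1}F` with `κ = (2−5g)/g < −5` has its boundary term killed AT
INFINITY by the class bound, and the floor-free bootstrap empties every ball.  After this file (+ ns-ezl-w6's `g = 0`) the past/shifted power-clock
residue in the weak class is exactly the own-rate window `g ∈ [2/5, 1/(2+ρ)]`.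

* `NegClock.profile_energy_growth_of_gaugeA_past_negRate` — the `A`-gauge at rate `g ≤ 0` (twin of ns-ezl-w4's `OffRate.…gaugeA_past_rate`);
* `NegClock.exists_locData_past_neg` — class-`ρ` (A₁)(E₁)(D₁) + Poisson + the rate-`g` LEE for a past-exact member at rate `g < 0`;
* `NegClock.selfSimilar_ae_eq_zero_of_neg_rate_past` — the member theorem.

WHAT THIS IS NOT: not NS, not E — a stratum of the crux CLASS 19832 on the MODEL lattice, `--supports` stmt-19832; 19832 OPEN.
[folklore; cf. BronziShvydkoy2015 Thm 1.1, ChaeShvydkoy2013 §2.2]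
-/

noncomputable section

-- flat `Theorems/<Route><Decl>…` files of one crux share the namespace of the crux (tree convention: `Summit.<S>.<S>.…`)
set_option linter.dupNamespace false

open MeasureTheory Set Filter Topology Metric Function TopologicalSpace
open scoped ENNReal NNReal InnerProductSpace RealInnerProductSpace Laplacian

namespace Summit.NavierStokesRegularity.NavierStokesRegularity.Theorems.PowerGaugeEulerLiouville

open Literature.Analysis Literature.Analysis.FunctionSpaces Literature.Analysis.FluidPDE

namespace NegClock

variable {ρ g T T₁ : ℝ} {x₀ : EuclideanSpace ℝ (Fin 3)}
  {u : ℝ → EuclideanSpace ℝ (Fin 3) → EuclideanSpace ℝ (Fin 3)} {p : ℝ → EuclideanSpace ℝ (Fin 3) → ℝ}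
  {H : ℝ → EuclideanSpace ℝ (Fin 3) → EuclideanSpace ℝ (Fin 3) →L[ℝ] EuclideanSpace ℝ (Fin 3)} {c : ℝ≥0}
  {W : EuclideanSpace ℝ (Fin 3) → EuclideanSpace ℝ (Fin 3)} {P : EuclideanSpace ℝ (Fin 3) → ℝ}

/-! ### The far-past slice: `A`-growth of the profile at a non-positive rate -/

/-- **THE `A`-GAUGE OF A PAST-EXACT MEMBER OF ANY RATE IN PROFILE VARIABLES (large scales).**  If `u(τ, x) = (T−τ)^{g−1} W((T−τ)^{−g}(x − x₀))` for
`τ < T₁` (`g ≤ 0`, `0 ≤ ρ ≤ ½`, `T₁ ≤ 0`, `T₁ ≤ T`) and `a^{2ρ} A(a; 0) ≤ c` for all `a > 0`, then for some `C < ∞`: `∫_{B_L} ‖W‖² ≤ C L^{1−2ρ}` for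
every `L ≥ 2 − T₁` (the gauge on the far-past slice `τ = T₁ − 1` at radius `a = L + ‖x₀‖ ≥ L(T−T₁+1)^g + ‖x₀‖` and the space change of
variables `y ↦ x₀ + (T−T₁+1)^g y`).  The `g ≤ 0` twin of ns-ezl-w4's `OffRate.profile_energy_growth_of_gaugeA_past_rate` (`g ≥ 0`). [folklore] -/
theorem profile_energy_growth_of_gaugeA_past_negRate (hρ : 0 ≤ ρ) (hρh : ρ ≤ 1 / 2) (hg : g ≤ 0) (hT₁ : T₁ ≤ 0) (hTT₁ : T₁ ≤ T)
    (x₀ : EuclideanSpace ℝ (Fin 3))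
    (hu : ∀ τ : ℝ, τ < T₁ → u τ = fun x => selfSimilarCollapse g T W τ (x - x₀))
    (hA : ∀ a : ℝ, 0 < a → ENNReal.ofReal (a ^ (2 * ρ)) *
      cknA a (0 : ℝ × EuclideanSpace ℝ (Fin 3)) u ≤ (c : ℝ≥0∞)) :
    ∃ C : ℝ≥0∞, C ≠ ⊤ ∧ ∀ L : ℝ, 2 - T₁ ≤ L →
      ∫⁻ y in ball (0 : EuclideanSpace ℝ (Fin 3)) L, ‖W y‖ₑ ^ 2 ≤ C * ENNReal.ofReal (L ^ (1 - 2 * ρ)) := by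
  -- adapted from `OffRate.profile_energy_growth_of_gaugeA_past_rate` (…SelfSimilarOffRatePastGrowth, ns-ezl-w4): radius `a = L + ‖x₀‖` since `σ = s^g ≤ 1`
  have _h := hρ
  -- the far-past slice `τ₁ = T₁ − 1` and `s = T − τ₁ ≥ 1`
  set τ₁ : ℝ := T₁ - 1 with hτ₁
  set s : ℝ := T - T₁ + 1 with hs
  have hs0 : 0 < s := by rw [hs]; linarith
  have hsτ : T - τ₁ = s := by rw [hτ₁, hs]; ring
  set σ : ℝ := s ^ g with hσ
  have hσ0 : 0 < σ := Real.rpow_pos_of_pos hs0 _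
  have h12ρ : 0 ≤ 1 - 2 * ρ := by linarith
  set k : ℝ := s ^ (2 - 2 * g) * (σ ^ 3)⁻¹ * (1 + ‖x₀‖) ^ (1 - 2 * ρ) with hk
  refine ⟨ENNReal.ofReal k * (c : ℝ≥0∞), ENNReal.mul_ne_top ENNReal.ofReal_ne_top ENNReal.coe_ne_top, fun L hL => ?_⟩
  have hL2 : 2 ≤ L := by linarith
  have hL0 : 0 < L := by linarith
  -- the radius `a` (for `g ≤ 0`: `σ = s^g ≤ 1`, so `a = L + ‖x₀‖` contains the rescaled ball `x₀ + σ B_L`)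
  set a : ℝ := L + ‖x₀‖ with ha
  have hσ1 : σ ≤ 1 := by
    rw [hσ]; exact Real.rpow_le_one_of_one_le_of_nonpos (by rw [hs]; linarith) hg
  have haL : L ≤ a := by
    have := norm_nonneg x₀
    rw [ha]; linarith
  have ha0 : 0 < a := by linarith
  have ha2 : 1 - T₁ < a ^ 2 := by nlinarith
  have hτ : τ₁ ∈ Ioo ((0 : ℝ × EuclideanSpace ℝ (Fin 3)).1 - a ^ 2) (0 : ℝ × EuclideanSpace ℝ (Fin 3)).1 := by
    simp only [Prod.fst_zero, zero_sub, mem_Ioo]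
    constructor <;> [rw [hτ₁]; rw [hτ₁]] <;> linarith
  have hslice : (ENNReal.ofReal a)⁻¹ * ∫⁻ x in ball (0 : EuclideanSpace ℝ (Fin 3)) a, ‖u τ₁ x‖ₑ ^ 2 ≤
      cknA a (0 : ℝ × EuclideanSpace ℝ (Fin 3)) u := by
    unfold cknA
    exact le_iSup₂ (f := fun t (_ : t ∈ Ioo ((0 : ℝ × EuclideanSpace ℝ (Fin 3)).1 - a ^ 2)
        (0 : ℝ × EuclideanSpace ℝ (Fin 3)).1) =>
        (ENNReal.ofReal a)⁻¹ * ∫⁻ x in ball (0 : ℝ × EuclideanSpace ℝ (Fin 3)).2 a, ‖u t x‖ₑ ^ 2) τ₁ hτ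
  set I : ℝ≥0∞ := ∫⁻ x in ball (0 : EuclideanSpace ℝ (Fin 3)) a, ‖u τ₁ x‖ₑ ^ 2 with hI
  have hgauge : ENNReal.ofReal (a ^ (2 * ρ)) * ((ENNReal.ofReal a)⁻¹ * I) ≤ (c : ℝ≥0∞) :=
    calc ENNReal.ofReal (a ^ (2 * ρ)) * ((ENNReal.ofReal a)⁻¹ * I)
        ≤ ENNReal.ofReal (a ^ (2 * ρ)) * cknA a (0 : ℝ × EuclideanSpace ℝ (Fin 3)) u := by gcongr
      _ ≤ (c : ℝ≥0∞) := hA a ha0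
  have hKa : ENNReal.ofReal (a ^ (2 * ρ)) * (ENNReal.ofReal a)⁻¹ = ENNReal.ofReal (a ^ (2 * ρ - 1)) := by
    rw [← ENNReal.ofReal_inv_of_pos ha0, ← ENNReal.ofReal_mul (by positivity), Real.rpow_sub_one ha0.ne',
      div_eq_mul_inv]
  have hIle : I ≤ ENNReal.ofReal (a ^ (1 - 2 * ρ)) * (c : ℝ≥0∞) := by
    have hunit : ENNReal.ofReal (a ^ (1 - 2 * ρ)) * ENNReal.ofReal (a ^ (2 * ρ - 1)) = 1 := by
      rw [← ENNReal.ofReal_mul (by positivity), ← Real.rpow_add ha0, show (1 - 2 * ρ) + (2 * ρ - 1) = 0 by ring,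
        Real.rpow_zero, ENNReal.ofReal_one]
    calc I = ENNReal.ofReal (a ^ (1 - 2 * ρ)) * (ENNReal.ofReal (a ^ (2 * ρ - 1)) * I) := by
          rw [← mul_assoc, hunit, one_mul]
      _ = ENNReal.ofReal (a ^ (1 - 2 * ρ)) * (ENNReal.ofReal (a ^ (2 * ρ)) * ((ENNReal.ofReal a)⁻¹ * I)) := by
          rw [← mul_assoc (ENNReal.ofReal (a ^ (2 * ρ))), hKa]
      _ ≤ ENNReal.ofReal (a ^ (1 - 2 * ρ)) * (c : ℝ≥0∞) := by gcongr
  -- ### change of variables `x = x₀ + σ y` on the far-past slice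
  have hval : ∀ y : EuclideanSpace ℝ (Fin 3),
      ‖u τ₁ (x₀ + σ • y)‖ₑ ^ 2 = ENNReal.ofReal (s ^ (2 * (g - 1))) * ‖W y‖ₑ ^ 2 := by
    intro y
    rw [hu τ₁ (by rw [hτ₁]; linarith)]
    simp only [selfSimilarCollapse_apply, add_sub_cancel_left, smul_smul]
    rw [hsτ, hσ, ← Real.rpow_add hs0, show -g + g = 0 by ring, Real.rpow_zero,
      one_smul, enorm_smul, mul_pow, Real.enorm_eq_ofReal (Real.rpow_nonneg hs0.le _),
      ← ENNReal.ofReal_pow (Real.rpow_nonneg hs0.le _), ← Real.rpow_natCast (s ^ (g - 1)) 2,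
      ← Real.rpow_mul hs0.le, show (g - 1) * ((2 : ℕ) : ℝ) = 2 * (g - 1) by push_cast; ring]
  have hpre : ball (0 : EuclideanSpace ℝ (Fin 3)) L ⊆
      (fun y : EuclideanSpace ℝ (Fin 3) => x₀ + σ • y) ⁻¹' ball (0 : EuclideanSpace ℝ (Fin 3)) a := by
    intro y hy
    rw [mem_ball_zero_iff] at hy
    rw [mem_preimage, mem_ball_zero_iff]
    calc ‖x₀ + σ • y‖ ≤ ‖x₀‖ + ‖σ • y‖ := norm_add_le _ _
      _ = ‖x₀‖ + σ * ‖y‖ := by rw [norm_smul, Real.norm_of_nonneg hσ0.le]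
      _ < ‖x₀‖ + σ * L := by gcongr
      _ ≤ ‖x₀‖ + 1 * L := by gcongr
      _ = a := by rw [ha]; ring
  have hcov := setLIntegral_preimage_comp_space_affine hσ0 x₀
    (fun x : EuclideanSpace ℝ (Fin 3) => ‖u τ₁ x‖ₑ ^ 2) (ball (0 : EuclideanSpace ℝ (Fin 3)) a)
  rw [finrank_euclideanSpace_fin] at hcov
  have hmain : ENNReal.ofReal (s ^ (2 * (g - 1))) * ∫⁻ y in ball (0 : EuclideanSpace ℝ (Fin 3)) L, ‖W y‖ₑ ^ 2 ≤
      ENNReal.ofReal (σ ^ 3)⁻¹ * I := by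
    rw [← hcov, ← lintegral_const_mul' _ _ ENNReal.ofReal_ne_top]
    calc ∫⁻ y in ball (0 : EuclideanSpace ℝ (Fin 3)) L, ENNReal.ofReal (s ^ (2 * (g - 1))) * ‖W y‖ₑ ^ 2
        = ∫⁻ y in ball (0 : EuclideanSpace ℝ (Fin 3)) L, ‖u τ₁ (x₀ + σ • y)‖ₑ ^ 2 :=
          lintegral_congr fun y => (hval y).symm
      _ ≤ ∫⁻ y in (fun y : EuclideanSpace ℝ (Fin 3) => x₀ + σ • y) ⁻¹' ball (0 : EuclideanSpace ℝ (Fin 3)) a,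
            ‖u τ₁ (x₀ + σ • y)‖ₑ ^ 2 := lintegral_mono_set hpre
  -- ### assemble
  have haL' : a ^ (1 - 2 * ρ) ≤ (1 + ‖x₀‖) ^ (1 - 2 * ρ) * L ^ (1 - 2 * ρ) := by
    rw [← Real.mul_rpow (by positivity) hL0.le]
    refine Real.rpow_le_rpow ha0.le ?_ h12ρ
    have : ‖x₀‖ ≤ ‖x₀‖ * L := le_mul_of_one_le_right (norm_nonneg _) (by linarith)
    rw [ha]; nlinarith
  have hunit2 : ENNReal.ofReal (s ^ (2 - 2 * g)) * ENNReal.ofReal (s ^ (2 * (g - 1))) = 1 := by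
    rw [← ENNReal.ofReal_mul (Real.rpow_nonneg hs0.le _), ← Real.rpow_add hs0,
      show (2 - 2 * g) + 2 * (g - 1) = 0 by ring, Real.rpow_zero, ENNReal.ofReal_one]
  calc ∫⁻ y in ball (0 : EuclideanSpace ℝ (Fin 3)) L, ‖W y‖ₑ ^ 2
      = ENNReal.ofReal (s ^ (2 - 2 * g)) *
          (ENNReal.ofReal (s ^ (2 * (g - 1))) * ∫⁻ y in ball (0 : EuclideanSpace ℝ (Fin 3)) L, ‖W y‖ₑ ^ 2) := by
        rw [← mul_assoc, hunit2, one_mul]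
    _ ≤ ENNReal.ofReal (s ^ (2 - 2 * g)) * (ENNReal.ofReal (σ ^ 3)⁻¹ * I) := by gcongr
    _ ≤ ENNReal.ofReal (s ^ (2 - 2 * g)) * (ENNReal.ofReal (σ ^ 3)⁻¹ *
          (ENNReal.ofReal (a ^ (1 - 2 * ρ)) * (c : ℝ≥0∞))) := by gcongr
    _ ≤ ENNReal.ofReal (s ^ (2 - 2 * g)) * (ENNReal.ofReal (σ ^ 3)⁻¹ *
          (ENNReal.ofReal ((1 + ‖x₀‖) ^ (1 - 2 * ρ) * L ^ (1 - 2 * ρ)) * (c : ℝ≥0∞))) := by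
        gcongr
    _ = ENNReal.ofReal k * (c : ℝ≥0∞) * ENNReal.ofReal (L ^ (1 - 2 * ρ)) := by
        rw [hk, ENNReal.ofReal_mul (by positivity), ENNReal.ofReal_mul (by positivity),
          ENNReal.ofReal_mul (by positivity)]
        ring


/-! ### The class-`ρ` large-scale profile data of a past-exact negative-rate member -/

/-- **The profile data of a PAST-EXACT NEGATIVE-RATE member** (crux hypotheses verbatim, `0 < ρ ≤ ½`; `(u, p)` exactly self-similar about `(T, x₀)` at
rate `g` for `τ < T₁`, `T₁ ≤ 0`, `T₁ ≤ T`, `g < 0`): a profile gradient `G` and ONE constant `c'` such that `W`, `P`, `G` are a.e.-strongly measurable,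
`G` is a weak derivative of `W`, the CLASS-`ρ` shapes (A₁) `∫_{B_L}|W|² ≤ c' L^{1−2ρ}`, (E₁) `∫_{B_L}|G|²_F ≤ L^{1−ρ}·((1−ρ)/(2+ρ))c'`,
(D₁) `∫_{B_L}|P|^{3/2} ≤ L^{2−2ρ}·((2−2ρ)/(2+ρ))c'` hold for `L ≥ 1`, together with the weak Poisson equation and the profile local energy equality
AT THE LITERAL RATE `g` (`ProfileEnergy.profile_local_energy_equality`, `γ := g`). [folklore] -/
theorem exists_locData_past_neg (hρ : 0 < ρ) (hρh : ρ ≤ 1 / 2) (hT₁ : T₁ ≤ 0) (hTT₁ : T₁ ≤ T) (x₀ : EuclideanSpace ℝ (Fin 3))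
    (hsw : IsSuitableWeakSolutionOn (slab (EuclideanSpace ℝ (Fin 3)) (Iio 0) isOpen_Iio) 0 0 u p)
    (hH : HasWeakSpatialGradientOn (slab (EuclideanSpace ℝ (Fin 3)) (Iio 0) isOpen_Iio) u H)
    (hgauge : ∀ a : ℝ, 0 < a →
      ENNReal.ofReal (a ^ (2 * ρ)) * cknA a (0 : ℝ × EuclideanSpace ℝ (Fin 3)) u +
          ENNReal.ofReal (a ^ ρ) * cknE a (0 : ℝ × EuclideanSpace ℝ (Fin 3)) H +
        ENNReal.ofReal (a ^ (2 * ρ)) * cknD a (0 : ℝ × EuclideanSpace ℝ (Fin 3)) p ≤ (c : ℝ≥0∞))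
    (hg : g < 0)
    (hu : ∀ τ : ℝ, τ < T₁ → u τ = fun x => selfSimilarCollapse g T W τ (x - x₀))
    (hp : ∀ τ : ℝ, τ < T₁ → p τ = fun x => selfSimilarCollapsePressure g T P τ (x - x₀)) :
    ∃ (G : EuclideanSpace ℝ (Fin 3) → EuclideanSpace ℝ (Fin 3) →L[ℝ] EuclideanSpace ℝ (Fin 3)) (c' : ℝ≥0),
      AEStronglyMeasurable W volume ∧ AEStronglyMeasurable P volume ∧ AEStronglyMeasurable G volume ∧
      HasWeakFDerivOn (⊤ : Opens (EuclideanSpace ℝ (Fin 3))) volume W G ∧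
      (∀ L : ℝ, 1 ≤ L → ∫⁻ y in ball (0 : EuclideanSpace ℝ (Fin 3)) L, ‖W y‖ₑ ^ 2 ≤
        (c' : ℝ≥0∞) * ENNReal.ofReal (L ^ (1 - 2 * ρ))) ∧
      (∀ L : ℝ, 1 ≤ L →
        ∫⁻ y in ball (0 : EuclideanSpace ℝ (Fin 3)) L, ENNReal.ofReal (frobeniusNormSq (G y)) ≤
          ENNReal.ofReal (L ^ (1 - ρ)) * (ENNReal.ofReal ((1 - ρ) / (2 + ρ)) * (c' : ℝ≥0∞))) ∧
      (∀ L : ℝ, 1 ≤ L →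
        ∫⁻ y in ball (0 : EuclideanSpace ℝ (Fin 3)) L, ‖P y‖ₑ ^ (3 / 2 : ℝ) ≤
          ENNReal.ofReal (L ^ (2 - 2 * ρ)) * (ENNReal.ofReal ((2 - 2 * ρ) / (2 + ρ)) * (c' : ℝ≥0∞))) ∧
      (∀ θ : EuclideanSpace ℝ (Fin 3) → ℝ, ContDiff ℝ (⊤ : ℕ∞) θ → HasCompactSupport θ →
        ∫ y, P y * (Δ θ) y = -∫ y, fderiv ℝ (fderiv ℝ θ) y (W y) (W y)) ∧
      (∀ σ : EuclideanSpace ℝ (Fin 3) → ℝ, IsTestFunctionOn (⊤ : Opens (EuclideanSpace ℝ (Fin 3))) σ →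
        (2 - 5 * g) * ∫ x, σ x * ‖W x‖ ^ 2 =
          (∫ x, (‖W x‖ ^ 2 + 2 * P x) * ⟪W x, gradient σ x⟫) +
            g * ∫ x, ‖W x‖ ^ 2 * ⟪x, gradient σ x⟫) := by
  -- adapted from `SlowClock.exists_locData_past_slow` (…SelfSimilarSlowClockPast, ns-ezl-w6) ← `OffRate.exists_locData_past` (ns-ezl-w4):
  -- same dictionary, the `A`/`E`/`D` bricks read at the rate `g ≤ 0`, the local energy equality kept at the LITERAL rate `g`
  have hρ1 : ρ < 1 := by linarith
  have h2ρ : (0 : ℝ) < 2 + ρ := by linarith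
  -- the three gauges separately
  have hA : ∀ a : ℝ, 0 < a → ENNReal.ofReal (a ^ (2 * ρ)) *
      cknA a (0 : ℝ × EuclideanSpace ℝ (Fin 3)) u ≤ (c : ℝ≥0∞) :=
    fun a ha => le_trans (le_trans le_self_add le_self_add) (hgauge a ha)
  have hE : ∀ a : ℝ, 0 < a → ENNReal.ofReal (a ^ ρ) *
      cknE a (0 : ℝ × EuclideanSpace ℝ (Fin 3)) H ≤ (c : ℝ≥0∞) :=
    fun a ha => le_trans (le_trans le_add_self le_self_add) (hgauge a ha)
  have hD : ∀ a : ℝ, 0 < a → ENNReal.ofReal (a ^ (2 * ρ)) *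
      cknD a (0 : ℝ × EuclideanSpace ℝ (Fin 3)) p ≤ (c : ℝ≥0∞) :=
    fun a ha => le_trans le_add_self (hgauge a ha)
  -- ### the origin-centred extension: a distributional Euler pair on the whole slab (rate `g`)
  have hsol : IsDistributionalNSSolutionOn (slab (EuclideanSpace ℝ (Fin 3)) (Iio 0) isOpen_Iio) 0 0 u p :=
    hsw.distributional
  have hext := Shifted.isDistributional_selfSimilarCollapse_of_past hT₁ hTT₁ x₀ hsol hu hp
  -- ### measurability
  have hum' : AEStronglyMeasurable (uncurry (selfSimilarCollapse g 0 W))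
      (volume.restrict (Iio (0 : ℝ) ×ˢ (univ : Set (EuclideanSpace ℝ (Fin 3))))) := by
    have := hext.1.aestronglyMeasurable
    simpa [slab] using this
  have hpm' : AEStronglyMeasurable (uncurry (selfSimilarCollapsePressure g 0 P))
      (volume.restrict (Iio (0 : ℝ) ×ˢ (univ : Set (EuclideanSpace ℝ (Fin 3))))) := by
    have := hext.2.2.1.aestronglyMeasurable
    simpa [slab] using this
  have hWm : AEStronglyMeasurable W volume :=
    aestronglyMeasurable_profile (u := selfSimilarCollapse g 0 W) (V := W) hum' fun _ _ => rfl
  have hPm : AEStronglyMeasurable P volume :=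
    aestronglyMeasurable_pressureProfile (p := selfSimilarCollapsePressure g 0 P) (P := P) hpm' fun _ _ => rfl
  have hpm : AEStronglyMeasurable (uncurry p)
      (volume.restrict (Iio (0 : ℝ) ×ˢ (univ : Set (EuclideanSpace ℝ (Fin 3))))) := by
    have := hsol.2.2.1.aestronglyMeasurable
    simpa [slab] using this
  have hHm : AEStronglyMeasurable (uncurry H)
      (volume.restrict (Iio (0 : ℝ) ×ˢ (univ : Set (EuclideanSpace ℝ (Fin 3))))) := by
    have := hH.locallyIntegrableOn_grad.aestronglyMeasurable
    simpa [slab] using this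
  -- ### the profile gradient (rate `g`, past form)
  obtain ⟨G, hGm, hWG, hHae⟩ := Past.exists_profileGradient_ae_of_past hH hT₁ hTT₁ x₀ hu
  -- ### the large-scale gauge data, read at the rate `g ≤ 0` in the class-`ρ` shapes
  obtain ⟨CA, hCA, hA''⟩ := profile_energy_growth_of_gaugeA_past_negRate hρ.le hρh hg.le hT₁ hTT₁ x₀ hu hA
  obtain ⟨CE, hCE, hE''⟩ := profile_gradient_growth_of_gaugeE_past_negRate hρ1 hg.le hT₁ hTT₁ x₀ hHm hHae hE
  obtain ⟨CD, hCD, hD''⟩ := profile_pressure_growth_of_gaugeD_past_negRate hρ1 hg.le hT₁ hTT₁ x₀ hpm hp hD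
  -- ### integrability on all balls
  have hV2fin : ∀ r : ℝ, ∫⁻ y in ball (0 : EuclideanSpace ℝ (Fin 3)) r, ‖W y‖ₑ ^ 2 < ⊤ :=
    Past.lintegral_ball_lt_top_of_growth hCA hA''
  have hGfin : ∀ r : ℝ, ∫⁻ y in ball (0 : EuclideanSpace ℝ (Fin 3)) r, ENNReal.ofReal (frobeniusNormSq (G y)) < ⊤ :=
    Past.lintegral_ball_lt_top_of_growth hCE hE''
  have hPfin : ∀ r : ℝ, ∫⁻ y in ball (0 : EuclideanSpace ℝ (Fin 3)) r, ‖P y‖ₑ ^ (3 / 2 : ℝ) < ⊤ :=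
    Past.lintegral_ball_lt_top_of_growth hCD hD''
  have hV2R : ∀ r : ℝ, MemLp W 2 (volume.restrict (ball (0 : EuclideanSpace ℝ (Fin 3)) r)) :=
    Past.memLp_two_ball_of_lintegral_lt_top hWm hV2fin
  have hG2R : ∀ r : ℝ, MemLp G 2 (volume.restrict (ball (0 : EuclideanSpace ℝ (Fin 3)) r)) :=
    Past.memLp_two_ball_gradient_of_lintegral_lt_top hGm hGfin
  have hP32R : ∀ r : ℝ, MemLp P (3 / 2 : ℝ≥0∞) (volume.restrict (ball (0 : EuclideanSpace ℝ (Fin 3)) r)) :=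
    Past.memLp_threeHalves_ball_of_lintegral_lt_top hPm hPfin
  have hV6R : ∀ r : ℝ, MemLp W 6 (volume.restrict (ball (0 : EuclideanSpace ℝ (Fin 3)) r)) :=
    Past.memLp_six_ball_of_gradient hWm hWG hV2R hGfin
  -- ### local integrability of `W`, `|W|²`, `P`
  have hVloc : LocallyIntegrable W volume := locallyIntegrableOn_univ.1 (by
    simpa only [Opens.coe_top] using hWG.locallyIntegrableOn)
  have hV2loc : LocallyIntegrable (fun y => ‖W y‖ ^ 2) volume := by
    refine (locallyIntegrable_iff).2 fun K hK => ?_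
    obtain ⟨r, hr⟩ := hK.isBounded.subset_ball (0 : EuclideanSpace ℝ (Fin 3))
    have h := (hV2R r).integrable_norm_pow two_ne_zero
    exact IntegrableOn.mono_set (show IntegrableOn (fun y => ‖W y‖ ^ 2) (ball 0 r) volume from h) hr
  have hPloc : LocallyIntegrable P volume := by
    refine (locallyIntegrable_iff).2 fun K hK => ?_
    obtain ⟨r, hr⟩ := hK.isBounded.subset_ball (0 : EuclideanSpace ℝ (Fin 3))
    haveI : IsFiniteMeasure ((volume : Measure (EuclideanSpace ℝ (Fin 3))).restrict
        (ball (0 : EuclideanSpace ℝ (Fin 3)) r)) :=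
      isFiniteMeasure_restrict.2 measure_ball_lt_top.ne
    have h : IntegrableOn P (ball (0 : EuclideanSpace ℝ (Fin 3)) r) volume :=
      memLp_one_iff_integrable.1 ((hP32R r).mono_exponent (by
        rw [ENNReal.le_div_iff_mul_le (Or.inl (by norm_num)) (Or.inl (by norm_num))]; norm_num))
    exact h.mono_set hr
  -- ### the equations at rate `g`, read off the extension
  have heq := fun (ψ : EuclideanSpace ℝ (Fin 3) → EuclideanSpace ℝ (Fin 3))
      (hψ : IsTestFunctionOn (⊤ : Opens (EuclideanSpace ℝ (Fin 3))) ψ) =>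
    ProfileEquation.weak_profile_equation hext (fun _ _ => rfl) (fun _ _ => rfl) hVloc hV2loc hPloc hψ
  have hdiv : IsWeaklyDivFree W := ProfileEquation.profile_isWeaklyDivFree hext (fun _ _ => rfl) hVloc
  have hPoisson : ∀ θ : EuclideanSpace ℝ (Fin 3) → ℝ, ContDiff ℝ (⊤ : ℕ∞) θ → HasCompactSupport θ →
      ∫ y, P y * (Δ θ) y = -∫ y, fderiv ℝ (fderiv ℝ θ) y (W y) (W y) :=
    fun θ hθ hθc => Past.profile_pressure_poisson_of_distributional hext hum' (fun _ _ => rfl) (fun _ _ => rfl)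
      hV2loc hPloc hθ hθc
  have hEE : ∀ σ : EuclideanSpace ℝ (Fin 3) → ℝ, IsTestFunctionOn (⊤ : Opens (EuclideanSpace ℝ (Fin 3))) σ →
      (2 - 5 * g) * ∫ x, σ x * ‖W x‖ ^ 2 =
        (∫ x, (‖W x‖ ^ 2 + 2 * P x) * ⟪W x, gradient σ x⟫) +
          g * ∫ x, ‖W x‖ ^ 2 * ⟪x, gradient σ x⟫ :=
    fun σ hσ => ProfileEnergy.profile_local_energy_equality hWG hV6R hG2R hPm hP32R hdiv heq hσ
  -- ### thresholds to `L ≥ 1` and ONE common constant in the shapes (A₁), (E₁), (D₁)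
  have hL₀ : (1 : ℝ) ≤ 2 - T₁ := by linarith
  have hA1 := Past.growth_ge_one_of_growth_ge hL₀ (by linarith : (0 : ℝ) ≤ 1 - 2 * ρ) hA''
  have hE1 := Past.growth_ge_one_of_growth_ge hL₀ (by linarith : (0 : ℝ) ≤ 1 - ρ) hE''
  have hD1 := Past.growth_ge_one_of_growth_ge hL₀ (by linarith : (0 : ℝ) ≤ 2 - 2 * ρ) hD''
  set CA' : ℝ≥0∞ := CA * ENNReal.ofReal ((2 - T₁) ^ (1 - 2 * ρ)) with hCA'
  set CE' : ℝ≥0∞ := CE * ENNReal.ofReal ((2 - T₁) ^ (1 - ρ)) with hCE'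
  set CD' : ℝ≥0∞ := CD * ENNReal.ofReal ((2 - T₁) ^ (2 - 2 * ρ)) with hCD'
  have hCA't : CA' ≠ ⊤ := ENNReal.mul_ne_top hCA ENNReal.ofReal_ne_top
  have hCE't : CE' ≠ ⊤ := ENNReal.mul_ne_top hCE ENNReal.ofReal_ne_top
  have hCD't : CD' ≠ ⊤ := ENNReal.mul_ne_top hCD ENNReal.ofReal_ne_top
  set κE : ℝ := (1 - ρ) / (2 + ρ) with hκE
  set κD : ℝ := (2 - 2 * ρ) / (2 + ρ) with hκD
  have hκE0 : 0 < κE := by rw [hκE]; exact div_pos (by linarith) h2ρ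
  have hκD0 : 0 < κD := by rw [hκD]; exact div_pos (by linarith) h2ρ
  set a : ℝ := CA'.toReal with ha
  set e : ℝ := CE'.toReal with he
  set d : ℝ := CD'.toReal with hd
  have ha0 : 0 ≤ a := ENNReal.toReal_nonneg
  have he0 : 0 ≤ e := ENNReal.toReal_nonneg
  have hd0 : 0 ≤ d := ENNReal.toReal_nonneg
  set c₀ : ℝ := a + e / κE + d / κD with hc₀
  have hc₀0 : 0 ≤ c₀ := by positivity
  set c' : ℝ≥0 := c₀.toNNReal with hc'
  have hcc : (c' : ℝ≥0∞) = ENNReal.ofReal c₀ := rfl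
  have haC : CA' = ENNReal.ofReal a := (ENNReal.ofReal_toReal hCA't).symm
  have heC : CE' = ENNReal.ofReal e := (ENNReal.ofReal_toReal hCE't).symm
  have hdC : CD' = ENNReal.ofReal d := (ENNReal.ofReal_toReal hCD't).symm
  have hAle : CA' ≤ (c' : ℝ≥0∞) := by
    rw [haC, hcc]
    refine ENNReal.ofReal_le_ofReal ?_
    have : 0 ≤ e / κE + d / κD := by positivity
    rw [hc₀]; linarith
  have hEle : CE' ≤ ENNReal.ofReal κE * (c' : ℝ≥0∞) := by
    rw [heC, hcc, ← ENNReal.ofReal_mul hκE0.le]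
    refine ENNReal.ofReal_le_ofReal ?_
    have h1 : κE * (e / κE) = e := mul_div_cancel₀ e hκE0.ne'
    have h2 : 0 ≤ κE * a + κE * (d / κD) := by positivity
    rw [hc₀]; nlinarith [h1, h2]
  have hDle : CD' ≤ ENNReal.ofReal κD * (c' : ℝ≥0∞) := by
    rw [hdC, hcc, ← ENNReal.ofReal_mul hκD0.le]
    refine ENNReal.ofReal_le_ofReal ?_
    have h1 : κD * (d / κD) = d := mul_div_cancel₀ d hκD0.ne'
    have h2 : 0 ≤ κD * a + κD * (e / κE) := by positivity
    rw [hc₀]; nlinarith [h1, h2]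
  refine ⟨G, c', hWm, hPm, hGm, hWG, fun L hL => (hA1 L hL).trans (mul_le_mul' hAle le_rfl),
    fun L hL => (hE1 L hL).trans ?_, fun L hL => (hD1 L hL).trans ?_, hPoisson, hEE⟩
  · rw [mul_comm]; exact mul_le_mul' le_rfl hEle
  · rw [mul_comm]; exact mul_le_mul' le_rfl hDle

/-! ### Negative-rate power clocks are trivial -/

/-- **WEAK NEGATIVE-RATE POWER CLOCKS ARE TRIVIAL.**  Crux hypotheses verbatim (`0 < ρ ≤ ½`, weak class) + exact self-similarity of `(u, p)`
about `(T, x₀)` at a NEGATIVE rate `g < 0`, FOR `τ < T₁` ONLY (`T₁ ≤ 0`, `T₁ ≤ T`; binder shape of ns-ezl-w6's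
`SlowClock.selfSimilar_ae_eq_zero_of_slow_rate_past` / ns-ezl-w4's `OffRate.selfSimilar_ae_eq_zero_of_rate_window_past` with the rate clause
replaced by `g < 0`) ⇒ `u = 0` a.e. on `(−∞,0) × ℝ³` — NO energy bound, NO hypothesis on the profile (supersedes in content this seat's classical
tame stratum `NegRateClock.ae_eq_zero_of_gauge_of_tameNegRateClock`).  (`PastShape.…slowPowerClock` needed `T = T₁ = 0`, `x₀ = 0`;
`…PowerClockFiniteEnergy` needed `∫|W|² < ∞`.) [folklore; cf. BronziShvydkoy2015 Thm 1.1] -/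
theorem selfSimilar_ae_eq_zero_of_neg_rate_past (hρ : 0 < ρ) (hρh : ρ ≤ 1 / 2) (hT₁ : T₁ ≤ 0) (hTT₁ : T₁ ≤ T)
    (x₀ : EuclideanSpace ℝ (Fin 3))
    (hsw : IsSuitableWeakSolutionOn (slab (EuclideanSpace ℝ (Fin 3)) (Iio 0) isOpen_Iio) 0 0 u p)
    (hH : HasWeakSpatialGradientOn (slab (EuclideanSpace ℝ (Fin 3)) (Iio 0) isOpen_Iio) u H)
    (hgauge : ∀ a : ℝ, 0 < a →
      ENNReal.ofReal (a ^ (2 * ρ)) * cknA a (0 : ℝ × EuclideanSpace ℝ (Fin 3)) u +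
          ENNReal.ofReal (a ^ ρ) * cknE a (0 : ℝ × EuclideanSpace ℝ (Fin 3)) H +
        ENNReal.ofReal (a ^ (2 * ρ)) * cknD a (0 : ℝ × EuclideanSpace ℝ (Fin 3)) p ≤ (c : ℝ≥0∞))
    (hg : g < 0)
    (hu : ∀ τ : ℝ, τ < T₁ → u τ = fun x => selfSimilarCollapse g T W τ (x - x₀))
    (hp : ∀ τ : ℝ, τ < T₁ → p τ = fun x => selfSimilarCollapsePressure g T P τ (x - x₀)) :
    uncurry u =ᵐ[volume.restrict (Iio (0 : ℝ) ×ˢ (univ : Set (EuclideanSpace ℝ (Fin 3))))] 0 := by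
  have hρ1 : ρ < 1 := by linarith
  obtain ⟨G, c', hWm, hPm, hGm, hWG, hA₁, hE₁, hD₁, hPoisson, hEE⟩ :=
    exists_locData_past_neg hρ hρh hT₁ hTT₁ x₀ hsw hH hgauge hg hu hp
  have hW0 : W =ᵐ[volume] 0 :=
    EnergySaturation.ae_eq_zero_of_negRate_loc hρ hρ1 hg hWm hPm hGm hWG hA₁ hE₁ hD₁ hPoisson hEE
  exact Past.ae_eq_zero_of_profile_ae_eq_zero hρ.le hTT₁ hsw hH hgauge hu hW0

end NegClock

end Summit.NavierStokesRegularity.NavierStokesRegularity.Theorems.PowerGaugeEulerLiouville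

end
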